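import Literature.MathematicalPhysics.QuantumFieldTheory.Balaban1983to89.B9Eq3124HZKnitPairReg335Y
import Literature.MathematicalPhysics.QuantumFieldTheory.Balaban1983to89.Node00.OpsYDeltaPrimeAFactor

/-!
# `Balaban1983to89.B9Eq325RIdentitiesKnitPairY` — T. Bałaban, *Propagators for lattice gauge theories in a background field*, Commun. Math. Phys. **99** (1985)
# 389–434 [Balaban1985BackgroundPropagators] (3.19)–(3.25) pp. 393–395, (3.119) p. 419, p. 425–426; T. Bałaban, *Averaging operations for lattice gauge theories*,
# Commun. Math. Phys. **98** (1985) 17–51 [Balaban1985Averaging] Prop. 2 p. 26: ★★ **`R G′ D*D R = R` AND `R D*D G′ R = R` AT THE KNIT PAIR** — def-Y's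
# (3.24)–(3.25) identities of `Node00.OpsYDeltaPrimeAFactor` §2 with the symmetrised transporter `parSymY` replaced by print's knit transporter `parKnitY`,
# and their corollaries on print's local class (3.35)

WHY (cell `pub-ymgap`, node N06, programme P-Q15 ∕ director-ym №375 «R2-A», def-Y's option (b) of 2026-08-30).  def-Y's v10 record makes the averaging
letter `𝔮` AND the site transport `parS` of the Sect.-D∕E composites parameters.  The (L8) supplier `hZ` of dag-n06-l
(`B9Eq3124HZKnitPairReg335Y.QknitY_gradY_GpPhysY_RY_parKnitY_of_reg335P`) is keyed at the knit pair `(QknitY, parKnitY)` — necessarily: (3.115) ties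
`Q(U) D_U` to the site average `Q′(U)` AT THE KNIT TRANSPORT.  For the certificate's rows 20–21 to sit at ONE site transport, the two `R`-identities
(3.151)∕(3.152) rest on — `R G′ D*D R = R`, `R D*D G′ R = R` — are needed at `parKnitY` too.  This file supplies them.

WHAT THIS FILE CHECKS (finite-dimensional algebra over landed letters; no estimate).
* §1 `avgKernelY_eq_of_inv_symm` — def-Y's (3.24) factorisation `kernelTrOpY (avgCoeffY i) (avgTrY i par U) = Q′(par)* ∘ Â ∘ Q′(par)` for EVERY
  inverse-symmetric transporter letter `par` (`par U z w = (par U w z)⁻¹`), every configuration and every coefficient algebra (def-Y's proof with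
  `parSymY_swap ↦ hinv`); at the knit letter (`B9B8AveragingJunction.parKnitY_inv`): `avgKernelY_parKnitY_eq`, `deltaPrimeAY_parKnitY_eq`.
* §2 at a `G`-valued background with `G`-valued knit legs, `G ≤ U(N)` — the hypotheses of dag-w's `B9B8KnitLetterProjectionC` (`XinvY_comp_XY_parKnitY`,
  `RY_parKnitY_idempotent`, `QpY_GpY_RY_parKnitY`) and of `B9Thm311PositivityKnitLetter.isUnit_deltaPrimeAY_parKnitY`: `RY_GpY_QpsY_parKnitY` (`R G′ Q′* = 0`),
  `RY_GpY_avgKernel_parKnitY` ∕ `avgKernel_GpY_RY_parKnitY`, `GpY_comp_lapSL_parKnitY` ∕ `lapSL_comp_GpY_parKnitY`, ★ `RY_GpY_lapSL_RY_parKnitY` ∕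
  `RY_lapSL_GpY_RY_parKnitY` (`R G′ Δ_U R = R`, `R Δ_U G′ R = R`), ★★ `RY_GpPhysY_divY_gradY_RY_parKnitY` ∕ `RY_divY_gradY_GpPhysY_RY_parKnitY` (print's units,
  `c_f η = 1`), `RY_GpPhysY_divY_gaugePiTY_parKnitY` ∕ `gaugePiY_gradY_GpPhysY_RY_parKnitY` (the gauge modes `D G′ R f` are what (3.119) removes).
* §3 ON PRINT's CLASS (3.35): at `G := U(N)` the leg hypothesis is DISCHARGED by `B9Eq3124HZKnitPairReg335Y.parKnitY_mem_unitary_of_reg335P`, giving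
  ★★★ `RY_GpPhysY_divY_gradY_RY_parKnitY_of_reg335P` ∕ `RY_divY_gradY_GpPhysY_RY_parKnitY_of_reg335P` ∕ `gaugePiY_gradY_GpPhysY_RY_parKnitY_of_reg335P` in
  the binder shape of the (L8) supplier (`hG1`, `hGU`, `hc : c₀ ≤ 10`, `hMα`, `hreg : (bg9KP …).Reg335 c₀ α₀ U`, x-free numerics `α₀′`).

HONEST SCOPE.  Algebra over landed definitions; no inequality of [B9] is proved or asserted; NOT a discharge of node N06, NOT summit progress; count-neutral;
nothing about the continuum limit, reflection positivity or the mass gap.  Cell `pub-ymgap` (HUMAN RULING D-0062), seat `pub-ymgap-dag-n06-l` (gen 35), 2026-08-30.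
-/

namespace Literature.MathematicalPhysics.QuantumFieldTheory.Balaban1983to89.B9Eq325RIdentitiesKnitPairY

open B6KLevelCensusIndexV1 (KIdx kGeo)
open B6Geom246MultiLevelBox (blkOf)
open B9Eq39Adjoint (R R_zero R_add R_smul)
open B9Thm311DeltaPrimeSymm (cornerY_levY_eq)
open B9B8AveragingJunction (parKnitY parKnitY_inv)
open B9B8KnitLetterProjectionC (XinvY_comp_XY_parKnitY XY_comp_XinvY_parKnitY RY_parKnitY_idempotent QpY_GpY_RY_parKnitY)
open B9Thm311PositivityKnitLetter (isUnit_deltaPrimeAY_parKnitY)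
open B9Eq3132SectDLetters (gaugePiY gaugePiTY)
open B7Prop2Explicit (C0 c2' unitaryUnits)
open B9C2FormBoxRegimeY (Kpl)
open B9BackgroundsKLevelV1P (bg9KP mem_of_reg335P)
open B9Eq3124HZKnitPairReg335Y (parKnitY_mem_unitary_of_reg335P)
open Node00
open scoped Matrix

noncomputable section

variable {d ℓ : ℕ} {hd : 1 ≤ d + 1} {hL : Odd (ℓ + 1) ∧ 1 < ℓ + 1} {b₀ b₁ : ℝ}

/-! ## §1 (3.24) factorised at any inverse-symmetric transporter letter, and at the knit letter -/

section Factor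

variable {𝔸 : Type} [NormedRing 𝔸] [NormedAlgebra ℂ 𝔸] [CompleteSpace 𝔸]
variable (i : KIdx d ℓ hd hL b₀ b₁)

omit [NormedAlgebra ℂ 𝔸] [CompleteSpace 𝔸] in
/-- `R(V)` of a finite sum. [cite: Balaban1985BackgroundPropagators, (3.19) p.393, bookkeeping] -/
private theorem R_finset_sum {ι : Type} (V : 𝔸ˣ) (s : Finset ι) (f : ι → 𝔸) : R V (∑ x ∈ s, f x) = ∑ x ∈ s, R V (f x) :=
  map_sum (⟨⟨R V, R_zero V⟩, R_add V⟩ : 𝔸 →+ 𝔸) f s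

/-- the transporter bookkeeping at an inverse-symmetric letter: `U(Γ_{c,z})⁻¹ · U(Γ_{c,w}) = avgTr(z, w)` (`c` the corner of the block of `z`).
[cite: Balaban1985BackgroundPropagators, (3.19) p.393, (3.24) p.394] -/
theorem qpT_inv_mul_qpT_of_inv_symm (par : SiteParY 𝔸 i) (U : CfgY 𝔸 i) (hinv : ∀ z w : SiteY i, par U z w = (par U w z)⁻¹) (z w : SiteY i) :
    (qpT i par U (blkOf i.D.toDomains z) z)⁻¹ * qpT i par U (blkOf i.D.toDomains z) w = avgTrY i par U z w := by
  show (par U (blkCornerY i (blkOf i.D.toDomains z)) z)⁻¹ * par U (blkCornerY i (blkOf i.D.toDomains z)) w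
      = par U z (cornerY i (levY i z) z) * par U (cornerY i (levY i z) z) w
  rw [cornerY_levY_eq, hinv z]

/-- ★ **(3.24) factorised at ANY inverse-symmetric transporter letter**: `kernelTrOpY (avgCoeffY i) (avgTrY i par U) = Q′(par;U)* ∘ Â ∘ Q′(par;U)`, for every
configuration and every coefficient algebra (def-Y's `avgKernelY_parSymY_eq` with `parSymY_swap ↦ hinv`). [cite: Balaban1985BackgroundPropagators, (3.24) p.394, (3.19) p.393] -/
theorem avgKernelY_eq_of_inv_symm (par : SiteParY 𝔸 i) (U : CfgY 𝔸 i) (hinv : ∀ z w : SiteY i, par U z w = (par U w z)⁻¹) :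
    kernelTrOpY (avgCoeffY i) (avgTrY i par U) = QpsY i par U ∘ₗ blkScaleY i (avgWtY i) ∘ₗ QpY i par U := by
  refine LinearMap.ext fun Λ => funext fun z => ?_
  rw [kernelTrOpY_apply, LinearMap.comp_apply, LinearMap.comp_apply, QpsY, trLiftY_apply,
    Finset.sum_eq_single (blkOf i.D.toDomains z)]
  · have hq1 : qpsK i z (blkOf i.D.toDomains z) = 1 := by
      show (if blkOf i.D.toDomains z = blkOf i.D.toDomains z then (1 : ℝ) else 0) = 1
      exact if_pos rfl
    rw [hq1, Complex.ofReal_one, one_smul, blkScaleY_apply, QpY, trLiftY_apply, R_smul, R_finset_sum, Finset.smul_sum]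
    refine Finset.sum_congr rfl fun w _ => ?_
    rw [R_smul, ← B9Eq39Adjoint.R_mul, qpT_inv_mul_qpT_of_inv_symm i par U hinv, smul_smul, ← Complex.ofReal_mul, avgWtY_mul_qpK]
  · intro s _ hs
    have hq0 : qpsK i z s = 0 := by
      show (if blkOf i.D.toDomains z = s then (1 : ℝ) else 0) = 0
      exact if_neg fun h => hs h.symm
    rw [hq0, Complex.ofReal_zero, zero_smul]
  · intro h
    exact absurd (Finset.mem_univ _) h

/-- `Δ′_a(U) = Δ_U + Q′(par;U)* Â Q′(par;U)` at any inverse-symmetric letter. [cite: Balaban1985BackgroundPropagators, (3.24) p.394] -/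
theorem deltaPrimeAY_eq_of_inv_symm (par : SiteParY 𝔸 i) (U : CfgY 𝔸 i) (hinv : ∀ z w : SiteY i, par U z w = (par U w z)⁻¹) :
    deltaPrimeAY i par U = lapSL i U + QpsY i par U ∘ₗ blkScaleY i (avgWtY i) ∘ₗ QpY i par U := by
  rw [deltaPrimeAY, avgKernelY_eq_of_inv_symm i par U hinv]

/-- ★ **(3.24) factorised AT THE KNIT LETTER**: `kernelTrOpY (avgCoeffY i) (avgTrY i parKnitY U) = Q′_knit(U)* ∘ Â ∘ Q′_knit(U)`, every `U`, every `𝔸`.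
[cite: Balaban1985BackgroundPropagators, (3.24) p.394, (3.19) p.393] -/
theorem avgKernelY_parKnitY_eq (U : CfgY 𝔸 i) :
    kernelTrOpY (avgCoeffY i) (avgTrY i (parKnitY i) U) = QpsY i (parKnitY i) U ∘ₗ blkScaleY i (avgWtY i) ∘ₗ QpY i (parKnitY i) U :=
  avgKernelY_eq_of_inv_symm i (parKnitY i) U (parKnitY_inv i U)

/-- `Δ′_a(U) = Δ_U + Q′_knit(U)* Â Q′_knit(U)` at the knit letter. [cite: Balaban1985BackgroundPropagators, (3.24) p.394] -/
theorem deltaPrimeAY_parKnitY_eq (U : CfgY 𝔸 i) :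
    deltaPrimeAY i (parKnitY i) U = lapSL i U + QpsY i (parKnitY i) U ∘ₗ blkScaleY i (avgWtY i) ∘ₗ QpY i (parKnitY i) U :=
  deltaPrimeAY_eq_of_inv_symm i (parKnitY i) U (parKnitY_inv i U)

end Factor

/-! ## §2 At a `G`-valued background with `G`-valued knit legs, `G ≤ U(N)`: `R G′ Q′* = 0`, `R G′ Δ_U R = R`, `R D*D G′ R = R` at the knit pair -/

section Projection

open scoped Matrix.Norms.L2Operator

variable {N : ℕ} (i : KIdx d ℓ hd hL b₀ b₁) {G : Subgroup (Matrix (Fin N) (Fin N) ℂ)ˣ}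

/-- ★ **`R(U) G′(U) Q′(U)* = 0` at the knit pair** (`R = 1 − G′Q′*X⁻¹Q′G′`, `X = Q′G′²Q′*`, `X⁻¹X = 1`).
[cite: Balaban1985BackgroundPropagators, (3.20)–(3.21) p.394, (3.25) p.395] -/
theorem RY_GpY_QpsY_parKnitY (hG : G ≤ B7Prop2Explicit.unitaryUnits (Matrix (Fin N) (Fin N) ℂ)) {U : CfgY (Matrix (Fin N) (Fin N) ℂ) i}
    (hU : ∀ μ x, U μ x ∈ G) (hpar : ∀ z w : SiteY i, parKnitY i U z w ∈ G) :
    RY i (parKnitY i) (GpY i (parKnitY i)) U ∘ₗ GpY i (parKnitY i) U ∘ₗ QpsY i (parKnitY i) U = 0 := by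
  set Gp := GpY i (parKnitY i) U
  set Qp := QpY i (parKnitY i) U
  set Qps := QpsY i (parKnitY i) U
  set Xi := XinvY i (parKnitY i) (GpY i (parKnitY i)) U
  have hkey : Xi ∘ₗ (Qp ∘ₗ (Gp ∘ₗ (Gp ∘ₗ Qps))) = LinearMap.id := by
    have h := XinvY_comp_XY_parKnitY i hG hU hpar
    simp only [XY] at h
    exact h
  have hP : (Gp ∘ₗ (Qps ∘ₗ (Xi ∘ₗ (Qp ∘ₗ Gp)))) ∘ₗ (Gp ∘ₗ Qps) = Gp ∘ₗ Qps := by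
    simp only [LinearMap.comp_assoc]
    rw [hkey, LinearMap.comp_id]
  have hR : RY i (parKnitY i) (GpY i (parKnitY i)) U = LinearMap.id - Gp ∘ₗ (Qps ∘ₗ (Xi ∘ₗ (Qp ∘ₗ Gp))) := rfl
  rw [hR, LinearMap.sub_comp, LinearMap.id_comp, hP, sub_self]

/-- `R G′ (Q′*ÂQ′) = 0` at the knit pair. [cite: Balaban1985BackgroundPropagators, (3.24)–(3.25) p.394] -/
theorem RY_GpY_avgKernel_parKnitY (hG : G ≤ B7Prop2Explicit.unitaryUnits (Matrix (Fin N) (Fin N) ℂ)) {U : CfgY (Matrix (Fin N) (Fin N) ℂ) i}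
    (hU : ∀ μ x, U μ x ∈ G) (hpar : ∀ z w : SiteY i, parKnitY i U z w ∈ G) :
    RY i (parKnitY i) (GpY i (parKnitY i)) U ∘ₗ GpY i (parKnitY i) U ∘ₗ kernelTrOpY (avgCoeffY i) (avgTrY i (parKnitY i) U) = 0 := by
  rw [avgKernelY_parKnitY_eq]
  calc RY i (parKnitY i) (GpY i (parKnitY i)) U ∘ₗ GpY i (parKnitY i) U ∘ₗ QpsY i (parKnitY i) U ∘ₗ blkScaleY i (avgWtY i) ∘ₗ QpY i (parKnitY i) U
      = (RY i (parKnitY i) (GpY i (parKnitY i)) U ∘ₗ GpY i (parKnitY i) U ∘ₗ QpsY i (parKnitY i) U) ∘ₗ (blkScaleY i (avgWtY i) ∘ₗ QpY i (parKnitY i) U) := by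
        simp only [LinearMap.comp_assoc]
    _ = 0 := by rw [RY_GpY_QpsY_parKnitY i hG hU hpar, LinearMap.zero_comp]

/-- `(Q′*ÂQ′) G′ R = 0` at the knit pair (dag-w's `Q′G′R = 0`). [cite: Balaban1985BackgroundPropagators, (3.24)–(3.25) p.394] -/
theorem avgKernel_GpY_RY_parKnitY (hG : G ≤ B7Prop2Explicit.unitaryUnits (Matrix (Fin N) (Fin N) ℂ)) {U : CfgY (Matrix (Fin N) (Fin N) ℂ) i}
    (hU : ∀ μ x, U μ x ∈ G) (hpar : ∀ z w : SiteY i, parKnitY i U z w ∈ G) :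
    kernelTrOpY (avgCoeffY i) (avgTrY i (parKnitY i) U) ∘ₗ GpY i (parKnitY i) U ∘ₗ RY i (parKnitY i) (GpY i (parKnitY i)) U = 0 := by
  rw [avgKernelY_parKnitY_eq]
  simp only [LinearMap.comp_assoc]
  rw [QpY_GpY_RY_parKnitY i hG hU hpar, LinearMap.comp_zero, LinearMap.comp_zero]

/-- `G′(U) Δ_U = 1 − G′(U)(Q′*ÂQ′)(U)` at the knit pair (`Δ′_a` a unit by `isUnit_deltaPrimeAY_parKnitY`). [cite: Balaban1985BackgroundPropagators, (3.24)–(3.25) p.394] -/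
theorem GpY_comp_lapSL_parKnitY (hG : G ≤ B7Prop2Explicit.unitaryUnits (Matrix (Fin N) (Fin N) ℂ)) {U : CfgY (Matrix (Fin N) (Fin N) ℂ) i}
    (hU : ∀ μ x, U μ x ∈ G) (hpar : ∀ z w : SiteY i, parKnitY i U z w ∈ G) :
    GpY i (parKnitY i) U ∘ₗ lapSL i U = LinearMap.id - GpY i (parKnitY i) U ∘ₗ kernelTrOpY (avgCoeffY i) (avgTrY i (parKnitY i) U) := by
  have h1 : GpY i (parKnitY i) U ∘ₗ deltaPrimeAY i (parKnitY i) U = LinearMap.id :=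
    GpY_mul_deltaPrimeAY i (parKnitY i) U (isUnit_deltaPrimeAY_parKnitY i hG hU hpar)
  rw [eq_sub_iff_add_eq, ← LinearMap.comp_add, ← h1]
  rfl

/-- `Δ_U G′(U) = 1 − (Q′*ÂQ′)(U) G′(U)` at the knit pair. [cite: Balaban1985BackgroundPropagators, (3.24)–(3.25) p.394] -/
theorem lapSL_comp_GpY_parKnitY (hG : G ≤ B7Prop2Explicit.unitaryUnits (Matrix (Fin N) (Fin N) ℂ)) {U : CfgY (Matrix (Fin N) (Fin N) ℂ) i}
    (hU : ∀ μ x, U μ x ∈ G) (hpar : ∀ z w : SiteY i, parKnitY i U z w ∈ G) :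
    lapSL i U ∘ₗ GpY i (parKnitY i) U = LinearMap.id - kernelTrOpY (avgCoeffY i) (avgTrY i (parKnitY i) U) ∘ₗ GpY i (parKnitY i) U := by
  have h1 : deltaPrimeAY i (parKnitY i) U ∘ₗ GpY i (parKnitY i) U = LinearMap.id :=
    deltaPrimeAY_mul_GpY i (parKnitY i) U (isUnit_deltaPrimeAY_parKnitY i hG hU hpar)
  rw [eq_sub_iff_add_eq, ← LinearMap.add_comp, ← h1]
  rfl

/-- ★ **`R G′ Δ_U R = R` at the knit pair**: `R G′ Δ_U R = R·R − R G′ (Q′*ÂQ′) R = R − 0`.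
[cite: Balaban1985BackgroundPropagators, (3.24)–(3.25) p.394, p.425 («{A : RD*A = 0}»)] -/
theorem RY_GpY_lapSL_RY_parKnitY (hG : G ≤ B7Prop2Explicit.unitaryUnits (Matrix (Fin N) (Fin N) ℂ)) {U : CfgY (Matrix (Fin N) (Fin N) ℂ) i}
    (hU : ∀ μ x, U μ x ∈ G) (hpar : ∀ z w : SiteY i, parKnitY i U z w ∈ G) :
    RY i (parKnitY i) (GpY i (parKnitY i)) U ∘ₗ GpY i (parKnitY i) U ∘ₗ lapSL i U ∘ₗ RY i (parKnitY i) (GpY i (parKnitY i)) U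
      = RY i (parKnitY i) (GpY i (parKnitY i)) U := by
  set Rr := RY i (parKnitY i) (GpY i (parKnitY i)) U
  calc Rr ∘ₗ GpY i (parKnitY i) U ∘ₗ lapSL i U ∘ₗ Rr = Rr ∘ₗ (GpY i (parKnitY i) U ∘ₗ lapSL i U) ∘ₗ Rr := by
        simp only [LinearMap.comp_assoc]
    _ = Rr ∘ₗ Rr - (Rr ∘ₗ GpY i (parKnitY i) U ∘ₗ kernelTrOpY (avgCoeffY i) (avgTrY i (parKnitY i) U)) ∘ₗ Rr := by
        rw [GpY_comp_lapSL_parKnitY i hG hU hpar, LinearMap.sub_comp, LinearMap.id_comp, LinearMap.comp_sub]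
        simp only [LinearMap.comp_assoc]
    _ = Rr := by rw [RY_parKnitY_idempotent i hG hU hpar, RY_GpY_avgKernel_parKnitY i hG hU hpar, LinearMap.zero_comp, sub_zero]

/-- ★ **`R Δ_U G′ R = R` at the knit pair** (the mirror). [cite: Balaban1985BackgroundPropagators, (3.24)–(3.25) p.394, p.425] -/
theorem RY_lapSL_GpY_RY_parKnitY (hG : G ≤ B7Prop2Explicit.unitaryUnits (Matrix (Fin N) (Fin N) ℂ)) {U : CfgY (Matrix (Fin N) (Fin N) ℂ) i}
    (hU : ∀ μ x, U μ x ∈ G) (hpar : ∀ z w : SiteY i, parKnitY i U z w ∈ G) :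
    RY i (parKnitY i) (GpY i (parKnitY i)) U ∘ₗ lapSL i U ∘ₗ GpY i (parKnitY i) U ∘ₗ RY i (parKnitY i) (GpY i (parKnitY i)) U
      = RY i (parKnitY i) (GpY i (parKnitY i)) U := by
  set Rr := RY i (parKnitY i) (GpY i (parKnitY i)) U
  calc Rr ∘ₗ lapSL i U ∘ₗ GpY i (parKnitY i) U ∘ₗ Rr = Rr ∘ₗ (lapSL i U ∘ₗ GpY i (parKnitY i) U) ∘ₗ Rr := by
        simp only [LinearMap.comp_assoc]
    _ = Rr ∘ₗ Rr - Rr ∘ₗ (kernelTrOpY (avgCoeffY i) (avgTrY i (parKnitY i) U) ∘ₗ GpY i (parKnitY i) U ∘ₗ Rr) := by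
        rw [lapSL_comp_GpY_parKnitY i hG hU hpar, LinearMap.sub_comp, LinearMap.id_comp, LinearMap.comp_sub]
        simp only [LinearMap.comp_assoc]
    _ = Rr := by rw [RY_parKnitY_idempotent i hG hU hpar, avgKernel_GpY_RY_parKnitY i hG hU hpar, LinearMap.comp_zero, sub_zero]

/-- ★★ **`R G′_phys D*_U D_U R = R` at the knit pair in print's units** (`R = RY (parKnitY) (GpPhysY (parKnitY)) = RY … (GpY …)`, `G′_phys = η²G′`, `c_f η = 1`).
[cite: Balaban1985BackgroundPropagators, (3.21)–(3.25) p.394, p.425] -/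
theorem RY_GpPhysY_divY_gradY_RY_parKnitY (hG : G ≤ B7Prop2Explicit.unitaryUnits (Matrix (Fin N) (Fin N) ℂ)) (hcf : i.cf * etaS i = 1)
    {U : CfgY (Matrix (Fin N) (Fin N) ℂ) i} (hU : ∀ μ x, U μ x ∈ G) (hpar : ∀ z w : SiteY i, parKnitY i U z w ∈ G) :
    RY i (parKnitY i) (GpPhysY i (parKnitY i)) U ∘ₗ GpPhysY i (parKnitY i) U ∘ₗ divY i U ∘ₗ gradY i U ∘ₗ RY i (parKnitY i) (GpPhysY i (parKnitY i)) U
      = RY i (parKnitY i) (GpPhysY i (parKnitY i)) U := by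
  rw [RY_GpPhysY]
  calc RY i (parKnitY i) (GpY i (parKnitY i)) U ∘ₗ GpPhysY i (parKnitY i) U ∘ₗ divY i U ∘ₗ gradY i U ∘ₗ RY i (parKnitY i) (GpY i (parKnitY i)) U
      = RY i (parKnitY i) (GpY i (parKnitY i)) U ∘ₗ (GpPhysY i (parKnitY i) U ∘ₗ divY i U ∘ₗ gradY i U) ∘ₗ RY i (parKnitY i) (GpY i (parKnitY i)) U := by
        simp only [LinearMap.comp_assoc]
    _ = RY i (parKnitY i) (GpY i (parKnitY i)) U := by
        rw [GpPhysY_comp_divY_gradY i (parKnitY i) hcf U]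
        simpa only [LinearMap.comp_assoc] using RY_GpY_lapSL_RY_parKnitY i hG hU hpar

/-- ★★ **`R D*_U D_U G′_phys R = R` at the knit pair in print's units.** [cite: Balaban1985BackgroundPropagators, (3.21)–(3.25) p.394, p.425] -/
theorem RY_divY_gradY_GpPhysY_RY_parKnitY (hG : G ≤ B7Prop2Explicit.unitaryUnits (Matrix (Fin N) (Fin N) ℂ)) (hcf : i.cf * etaS i = 1)
    {U : CfgY (Matrix (Fin N) (Fin N) ℂ) i} (hU : ∀ μ x, U μ x ∈ G) (hpar : ∀ z w : SiteY i, parKnitY i U z w ∈ G) :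
    RY i (parKnitY i) (GpPhysY i (parKnitY i)) U ∘ₗ divY i U ∘ₗ gradY i U ∘ₗ GpPhysY i (parKnitY i) U ∘ₗ RY i (parKnitY i) (GpPhysY i (parKnitY i)) U
      = RY i (parKnitY i) (GpPhysY i (parKnitY i)) U := by
  rw [RY_GpPhysY]
  calc RY i (parKnitY i) (GpY i (parKnitY i)) U ∘ₗ divY i U ∘ₗ gradY i U ∘ₗ GpPhysY i (parKnitY i) U ∘ₗ RY i (parKnitY i) (GpY i (parKnitY i)) U
      = RY i (parKnitY i) (GpY i (parKnitY i)) U ∘ₗ (divY i U ∘ₗ gradY i U ∘ₗ GpPhysY i (parKnitY i) U) ∘ₗ RY i (parKnitY i) (GpY i (parKnitY i)) U := by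
        simp only [LinearMap.comp_assoc]
    _ = RY i (parKnitY i) (GpY i (parKnitY i)) U := by
        rw [divY_gradY_comp_GpPhysY i (parKnitY i) hcf U]
        simpa only [LinearMap.comp_assoc] using RY_lapSL_GpY_RY_parKnitY i hG hU hpar

/-- ★★ **`R G′ D* ∘ (1 − D R G′ D*) = 0` at the knit pair**: `R G′ D*` annihilates the range of the adjoint gauge projection `gaugePiTY` of (3.119).
[cite: Balaban1985BackgroundPropagators, (3.119) p.419, (3.147) p.425] -/
theorem RY_GpPhysY_divY_gaugePiTY_parKnitY (hG : G ≤ B7Prop2Explicit.unitaryUnits (Matrix (Fin N) (Fin N) ℂ)) (hcf : i.cf * etaS i = 1)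
    {U : CfgY (Matrix (Fin N) (Fin N) ℂ) i} (hU : ∀ μ x, U μ x ∈ G) (hpar : ∀ z w : SiteY i, parKnitY i U z w ∈ G) :
    RY i (parKnitY i) (GpPhysY i (parKnitY i)) U ∘ₗ GpPhysY i (parKnitY i) U ∘ₗ divY i U ∘ₗ gaugePiTY i (parKnitY i) (GpPhysY i (parKnitY i)) U = 0 := by
  have hkey := RY_GpPhysY_divY_gradY_RY_parKnitY i hG hcf hU hpar
  have hT : gaugePiTY i (parKnitY i) (GpPhysY i (parKnitY i)) U
      = LinearMap.id - gradY i U ∘ₗ RY i (parKnitY i) (GpPhysY i (parKnitY i)) U ∘ₗ GpPhysY i (parKnitY i) U ∘ₗ divY i U := rfl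
  rw [hT, LinearMap.comp_sub, LinearMap.comp_sub, LinearMap.comp_sub, LinearMap.comp_id,
    ← LinearMap.comp_assoc (GpPhysY i (parKnitY i) U ∘ₗ divY i U), ← LinearMap.comp_assoc (GpPhysY i (parKnitY i) U ∘ₗ divY i U),
    ← LinearMap.comp_assoc (GpPhysY i (parKnitY i) U ∘ₗ divY i U), ← LinearMap.comp_assoc (GpPhysY i (parKnitY i) U ∘ₗ divY i U), hkey, sub_self]

/-- ★★ **`(1 − D G′ R D*) ∘ D G′ R = 0` at the knit pair**: the gauge projection `gaugePiY` of (3.119) kills the gauge modes `D_U G′ R f`.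
[cite: Balaban1985BackgroundPropagators, (3.119) p.419, (3.147) p.425] -/
theorem gaugePiY_gradY_GpPhysY_RY_parKnitY (hG : G ≤ B7Prop2Explicit.unitaryUnits (Matrix (Fin N) (Fin N) ℂ)) (hcf : i.cf * etaS i = 1)
    {U : CfgY (Matrix (Fin N) (Fin N) ℂ) i} (hU : ∀ μ x, U μ x ∈ G) (hpar : ∀ z w : SiteY i, parKnitY i U z w ∈ G) :
    gaugePiY i (parKnitY i) (GpPhysY i (parKnitY i)) U ∘ₗ gradY i U ∘ₗ GpPhysY i (parKnitY i) U ∘ₗ RY i (parKnitY i) (GpPhysY i (parKnitY i)) U = 0 := by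
  have hkey := RY_divY_gradY_GpPhysY_RY_parKnitY i hG hcf hU hpar
  have h : (gradY i U ∘ₗ GpPhysY i (parKnitY i) U ∘ₗ RY i (parKnitY i) (GpPhysY i (parKnitY i)) U ∘ₗ divY i U) ∘ₗ
        (gradY i U ∘ₗ GpPhysY i (parKnitY i) U ∘ₗ RY i (parKnitY i) (GpPhysY i (parKnitY i)) U)
      = gradY i U ∘ₗ GpPhysY i (parKnitY i) U ∘ₗ (RY i (parKnitY i) (GpPhysY i (parKnitY i)) U ∘ₗ divY i U ∘ₗ gradY i U ∘ₗ
          GpPhysY i (parKnitY i) U ∘ₗ RY i (parKnitY i) (GpPhysY i (parKnitY i)) U) := by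
    simp only [LinearMap.comp_assoc]
  have hP : gaugePiY i (parKnitY i) (GpPhysY i (parKnitY i)) U
      = LinearMap.id - gradY i U ∘ₗ GpPhysY i (parKnitY i) U ∘ₗ RY i (parKnitY i) (GpPhysY i (parKnitY i)) U ∘ₗ divY i U := rfl
  rw [hP, LinearMap.sub_comp, LinearMap.id_comp, h, hkey, sub_self]

end Projection

/-! ## §3 On print's class (3.35): the leg hypothesis discharged at `G := U(N)` -/

section Reg335

open scoped Matrix.Norms.L2Operator

variable {N : ℕ} [Nonempty (Fin N)] (i : KIdx d ℓ hd hL b₀ b₁) {G : Subgroup (Matrix (Fin N) (Fin N) ℂ)ˣ}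

/-- ★★★ **`R G′_phys D*_U D_U R = R` AT THE KNIT PAIR ON (3.35)** — the (L8) supplier's binder shape: for every background of the member's class
`(bg9KP …).Reg335 c₀ α₀` with `G ≤ U(N)` unit-bounded, `c₀ ≤ 10`, `0 ≤ Mα₀`, the x-free numerics `K_pl(Mα₀)·L⁴ < α₀′`, `C₀α₀′ ≤ 1/3`, `2α₀′ ≤ c₂′`, and `c_f η = 1`
(knit legs unitary by `parKnitY_mem_unitary_of_reg335P`, then §2 at `G := U(N)`). [cite: Balaban1985BackgroundPropagators, (3.21)–(3.25) p.394, (3.35) p.396, p.425] -/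
theorem RY_GpPhysY_divY_gradY_RY_parKnitY_of_reg335P (hG1 : ∀ u : (Matrix (Fin N) (Fin N) ℂ)ˣ, u ∈ G → ‖(u : Matrix (Fin N) (Fin N) ℂ)‖ ≤ 1)
    (hGU : G ≤ unitaryUnits (Matrix (Fin N) (Fin N) ℂ))
    {U : CfgY (Matrix (Fin N) (Fin N) ℂ) i} {c₀ α₀ : ℝ} (hc : c₀ ≤ 10) (hMα : 0 ≤ (kGeo i).M * α₀)
    (hreg : (bg9KP (Matrix (Fin N) (Fin N) ℂ) G i).Reg335 c₀ α₀ U) {α₀' : ℝ} (hα' : 0 < α₀') (hα3 : C0 (d + 1) * α₀' ≤ 1 / 3)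
    (hα2 : 2 * α₀' ≤ c2' (d + 1) (ℓ + 1)) (hK : Kpl i ((kGeo i).M * α₀) * (kGeo i).L ^ 4 < α₀') (hcf : i.cf * etaS i = 1) :
    RY i (parKnitY i) (GpPhysY i (parKnitY i)) U ∘ₗ GpPhysY i (parKnitY i) U ∘ₗ divY i U ∘ₗ gradY i U ∘ₗ RY i (parKnitY i) (GpPhysY i (parKnitY i)) U
      = RY i (parKnitY i) (GpPhysY i (parKnitY i)) U :=
  RY_GpPhysY_divY_gradY_RY_parKnitY i (G := unitaryUnits _) le_rfl hcf (fun μ x => hGU (mem_of_reg335P (G := G) i hreg μ x))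
    (parKnitY_mem_unitary_of_reg335P i hG1 hGU U hc hMα hreg hα' hα3 hα2 hK)

/-- ★★★ **`R D*_U D_U G′_phys R = R` AT THE KNIT PAIR ON (3.35).** [cite: Balaban1985BackgroundPropagators, (3.21)–(3.25) p.394, (3.35) p.396, p.425] -/
theorem RY_divY_gradY_GpPhysY_RY_parKnitY_of_reg335P (hG1 : ∀ u : (Matrix (Fin N) (Fin N) ℂ)ˣ, u ∈ G → ‖(u : Matrix (Fin N) (Fin N) ℂ)‖ ≤ 1)
    (hGU : G ≤ unitaryUnits (Matrix (Fin N) (Fin N) ℂ))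
    {U : CfgY (Matrix (Fin N) (Fin N) ℂ) i} {c₀ α₀ : ℝ} (hc : c₀ ≤ 10) (hMα : 0 ≤ (kGeo i).M * α₀)
    (hreg : (bg9KP (Matrix (Fin N) (Fin N) ℂ) G i).Reg335 c₀ α₀ U) {α₀' : ℝ} (hα' : 0 < α₀') (hα3 : C0 (d + 1) * α₀' ≤ 1 / 3)
    (hα2 : 2 * α₀' ≤ c2' (d + 1) (ℓ + 1)) (hK : Kpl i ((kGeo i).M * α₀) * (kGeo i).L ^ 4 < α₀') (hcf : i.cf * etaS i = 1) :
    RY i (parKnitY i) (GpPhysY i (parKnitY i)) U ∘ₗ divY i U ∘ₗ gradY i U ∘ₗ GpPhysY i (parKnitY i) U ∘ₗ RY i (parKnitY i) (GpPhysY i (parKnitY i)) U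
      = RY i (parKnitY i) (GpPhysY i (parKnitY i)) U :=
  RY_divY_gradY_GpPhysY_RY_parKnitY i (G := unitaryUnits _) le_rfl hcf (fun μ x => hGU (mem_of_reg335P (G := G) i hreg μ x))
    (parKnitY_mem_unitary_of_reg335P i hG1 hGU U hc hMα hreg hα' hα3 hα2 hK)

/-- ★★ **`R G′ D* ∘ (1 − D R G′ D*) = 0` AT THE KNIT PAIR ON (3.35).** [cite: Balaban1985BackgroundPropagators, (3.119) p.419, (3.147) p.425, (3.35) p.396] -/
theorem RY_GpPhysY_divY_gaugePiTY_parKnitY_of_reg335P (hG1 : ∀ u : (Matrix (Fin N) (Fin N) ℂ)ˣ, u ∈ G → ‖(u : Matrix (Fin N) (Fin N) ℂ)‖ ≤ 1)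
    (hGU : G ≤ unitaryUnits (Matrix (Fin N) (Fin N) ℂ))
    {U : CfgY (Matrix (Fin N) (Fin N) ℂ) i} {c₀ α₀ : ℝ} (hc : c₀ ≤ 10) (hMα : 0 ≤ (kGeo i).M * α₀)
    (hreg : (bg9KP (Matrix (Fin N) (Fin N) ℂ) G i).Reg335 c₀ α₀ U) {α₀' : ℝ} (hα' : 0 < α₀') (hα3 : C0 (d + 1) * α₀' ≤ 1 / 3)
    (hα2 : 2 * α₀' ≤ c2' (d + 1) (ℓ + 1)) (hK : Kpl i ((kGeo i).M * α₀) * (kGeo i).L ^ 4 < α₀') (hcf : i.cf * etaS i = 1) :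
    RY i (parKnitY i) (GpPhysY i (parKnitY i)) U ∘ₗ GpPhysY i (parKnitY i) U ∘ₗ divY i U ∘ₗ gaugePiTY i (parKnitY i) (GpPhysY i (parKnitY i)) U = 0 :=
  RY_GpPhysY_divY_gaugePiTY_parKnitY i (G := unitaryUnits _) le_rfl hcf (fun μ x => hGU (mem_of_reg335P (G := G) i hreg μ x))
    (parKnitY_mem_unitary_of_reg335P i hG1 hGU U hc hMα hreg hα' hα3 hα2 hK)

/-- ★★ **`(1 − D G′ R D*) ∘ D G′ R = 0` AT THE KNIT PAIR ON (3.35).** [cite: Balaban1985BackgroundPropagators, (3.119) p.419, (3.147) p.425, (3.35) p.396] -/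
theorem gaugePiY_gradY_GpPhysY_RY_parKnitY_of_reg335P (hG1 : ∀ u : (Matrix (Fin N) (Fin N) ℂ)ˣ, u ∈ G → ‖(u : Matrix (Fin N) (Fin N) ℂ)‖ ≤ 1)
    (hGU : G ≤ unitaryUnits (Matrix (Fin N) (Fin N) ℂ))
    {U : CfgY (Matrix (Fin N) (Fin N) ℂ) i} {c₀ α₀ : ℝ} (hc : c₀ ≤ 10) (hMα : 0 ≤ (kGeo i).M * α₀)
    (hreg : (bg9KP (Matrix (Fin N) (Fin N) ℂ) G i).Reg335 c₀ α₀ U) {α₀' : ℝ} (hα' : 0 < α₀') (hα3 : C0 (d + 1) * α₀' ≤ 1 / 3)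
    (hα2 : 2 * α₀' ≤ c2' (d + 1) (ℓ + 1)) (hK : Kpl i ((kGeo i).M * α₀) * (kGeo i).L ^ 4 < α₀') (hcf : i.cf * etaS i = 1) :
    gaugePiY i (parKnitY i) (GpPhysY i (parKnitY i)) U ∘ₗ gradY i U ∘ₗ GpPhysY i (parKnitY i) U ∘ₗ RY i (parKnitY i) (GpPhysY i (parKnitY i)) U = 0 :=
  gaugePiY_gradY_GpPhysY_RY_parKnitY i (G := unitaryUnits _) le_rfl hcf (fun μ x => hGU (mem_of_reg335P (G := G) i hreg μ x))
    (parKnitY_mem_unitary_of_reg335P i hG1 hGU U hc hMα hreg hα' hα3 hα2 hK)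

/-- `R(U)` at the knit pair is an idempotent on (3.35). [cite: Balaban1985BackgroundPropagators, (3.20) p.394, (3.25) p.394, (3.35) p.396] -/
theorem RY_GpPhysY_parKnitY_idempotent_of_reg335P (hG1 : ∀ u : (Matrix (Fin N) (Fin N) ℂ)ˣ, u ∈ G → ‖(u : Matrix (Fin N) (Fin N) ℂ)‖ ≤ 1)
    (hGU : G ≤ unitaryUnits (Matrix (Fin N) (Fin N) ℂ))
    {U : CfgY (Matrix (Fin N) (Fin N) ℂ) i} {c₀ α₀ : ℝ} (hc : c₀ ≤ 10) (hMα : 0 ≤ (kGeo i).M * α₀)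
    (hreg : (bg9KP (Matrix (Fin N) (Fin N) ℂ) G i).Reg335 c₀ α₀ U) {α₀' : ℝ} (hα' : 0 < α₀') (hα3 : C0 (d + 1) * α₀' ≤ 1 / 3)
    (hα2 : 2 * α₀' ≤ c2' (d + 1) (ℓ + 1)) (hK : Kpl i ((kGeo i).M * α₀) * (kGeo i).L ^ 4 < α₀') :
    RY i (parKnitY i) (GpPhysY i (parKnitY i)) U ∘ₗ RY i (parKnitY i) (GpPhysY i (parKnitY i)) U = RY i (parKnitY i) (GpPhysY i (parKnitY i)) U := by
  rw [RY_GpPhysY]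
  exact RY_parKnitY_idempotent i (G := unitaryUnits _) le_rfl (fun μ x => hGU (mem_of_reg335P (G := G) i hreg μ x))
    (parKnitY_mem_unitary_of_reg335P i hG1 hGU U hc hMα hreg hα' hα3 hα2 hK)

/-- `Q′(U) G′(U) R(U) = 0` at the knit pair on (3.35) (lattice units). [cite: Balaban1985BackgroundPropagators, (3.20)–(3.21) p.394, (3.35) p.396] -/
theorem QpY_GpY_RY_parKnitY_of_reg335P (hG1 : ∀ u : (Matrix (Fin N) (Fin N) ℂ)ˣ, u ∈ G → ‖(u : Matrix (Fin N) (Fin N) ℂ)‖ ≤ 1)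
    (hGU : G ≤ unitaryUnits (Matrix (Fin N) (Fin N) ℂ))
    {U : CfgY (Matrix (Fin N) (Fin N) ℂ) i} {c₀ α₀ : ℝ} (hc : c₀ ≤ 10) (hMα : 0 ≤ (kGeo i).M * α₀)
    (hreg : (bg9KP (Matrix (Fin N) (Fin N) ℂ) G i).Reg335 c₀ α₀ U) {α₀' : ℝ} (hα' : 0 < α₀') (hα3 : C0 (d + 1) * α₀' ≤ 1 / 3)
    (hα2 : 2 * α₀' ≤ c2' (d + 1) (ℓ + 1)) (hK : Kpl i ((kGeo i).M * α₀) * (kGeo i).L ^ 4 < α₀') :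
    QpY i (parKnitY i) U ∘ₗ GpY i (parKnitY i) U ∘ₗ RY i (parKnitY i) (GpY i (parKnitY i)) U = 0 :=
  QpY_GpY_RY_parKnitY i (G := unitaryUnits _) le_rfl (fun μ x => hGU (mem_of_reg335P (G := G) i hreg μ x))
    (parKnitY_mem_unitary_of_reg335P i hG1 hGU U hc hMα hreg hα' hα3 hα2 hK)

end Reg335

end

end Literature.MathematicalPhysics.QuantumFieldTheory.Balaban1983to89.B9Eq325RIdentitiesKnitPairY
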